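import Summits.QuantumFields.YangMills.Theorems.ColdStartUniversalityLatticeLangevinPointwiseMixingUniform
import HarnessLib

/-!
# Route `ColdStartUniversality` (fixed-cut-off package, Bakry–Émery side): DYNAMIC CONCENTRATION OF THE ACTION DENSITY ABOUT ITS GIBBS MEAN
# from EVERY deterministic start — bias–variance, Chebyshev tail, thermalization time; window versions

Helper file (seat `ym-line-csu-p1`, g29; `--supports stmt-QuantumFields-24809`).  Combines the dynamic variance bound along every SZZ solution
(`wilson_solution_actionDensity_variance_le_uniform`: `Var(S_W(U_t)/#𝒫) ≤ 32/((1−12|β'|)#𝒫)`) with the every-start mixing of the mean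
(`wilson_solution_actionDensity_pointwise_mixing_uniform`: `|E S_W(U_t)/#𝒫 − μ_(β')(S_W/#𝒫)| ≤ 8π e^(−(1−12|β'|)t)`):
* ★★★ `wilson_solution_actionDensity_sqDev_gibbsMean_le_uniform` — `E[(S_W(U_t)/#𝒫 − μ_(β')(S_W/#𝒫))²] ≤ 32/((1−12|β'|)#𝒫) + (8π e^(−(1−12|β'|)t))²`
  for every strong solution from every deterministic start (e.g. COLD), every `L`, every `t`;
* ★★★ `wilson_solution_actionDensity_tail_gibbsMean_le_uniform` — Chebyshev: `P(|S_W(U_t)/#𝒫 − μ_(β')(S_W/#𝒫)| ≥ r) ≤ (32/((1−12|β'|)#𝒫) + 64π² e^(−2(1−12|β'|)t))/r²`;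
* ★★ `wilson_solution_actionDensity_thermalizationTime_uniform` — `t ≥ log(8π/δ)/(1−12|β'|) ⇒ |E S_W(U_t)/#𝒫 − μ_(β')(S_W/#𝒫)| ≤ δ` (VOLUME-FREE);
* ★★ `actionDensity_tail_gibbsMean_fixedCutoff_window`, `actionDensity_thermalizationTime_fixedCutoff_window` — at the route's cut-offs with `6 < γε_K`.
So along the cold-start evolution the action density is, after a volume-independent lattice time, close to its Gibbs mean not only in expectation
but with high probability (fluctuations `O(1/√(ρ#𝒫))`).  THEOREMS ONLY, no definition, no sorry.  [cite: BakryGentilLedoux2014, Thm 4.7.2 (ii) +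
Thm 3.3.18; ShenZhuZhu2022 §4].  HONEST FRAMING: fixed cut-off, FIXED `|β'| < 1/12` (window `6 < γε_K` at the route's cut-offs, eventually left
as `ε_K → 0`); nothing `K`-uniform; `UniformColdStartMixing` (stmt-24809, aside) is NOT restated or weakened; the Yang–Mills mass gap is NOT proved.
-/

set_option autoImplicit false

noncomputable section

namespace Summit.QuantumFields.YangMills.Theorems.ColdStartUniversality

open MeasureTheory ProbabilityTheory Matrix Complex Finset Filter Set Metric
open scoped ComplexConjugate BigOperators Matrix NNReal ENNReal Topology
open Literature.Probability.Process Literature.MathematicalPhysics.QuantumFieldTheory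
open Literature.MathematicalPhysics.QuantumFieldTheory.Balaban1983to89
open Literature.MathematicalPhysics.QuantumLattice (fundamentalRep fundamentalLatticeRep continuous_fundamentalRep fundamentalRep_apply)

variable {L : ℕ} [NeZero L]

/-- ★★★ **Mean-square deviation of the action density from its GIBBS mean along every SZZ solution (bias–variance).**  At `|β'| < 1/12`, for
every `L`, every strong solution `U` from a deterministic start and every `t ≥ 0`:
`E[(S_W(U_t)/#𝒫 − ∫ S_W/#𝒫 dμ_(β'))²] ≤ 32/((1−12|β'|)#𝒫) + (8π·e^(−(1−12|β'|)t))²`. [cite: BakryGentilLedoux2014, Thm 4.7.2 (ii), Thm 3.3.18] -/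
theorem wilson_solution_actionDensity_sqDev_gibbsMean_le_uniform (L : ℕ) [NeZero L] (β' : ℝ) (hβ : |β'| < 1 / 12)
    (t : ℝ≥0) (x₀ : (GaugeConfig 3 L (Matrix.specialUnitaryGroup (Fin 2) ℂ)))
    (Ω : Type) [MeasurableSpace Ω] (P : Measure Ω) [IsProbabilityMeasure P]
    (W : ℝ≥0 → Ω → (Edge 3 L × NoiseIdx 2 → ℝ)) (hW : IsFlatBrownian W P)
    (U : ℝ≥0 → Ω → (GaugeConfig 3 L (Matrix.specialUnitaryGroup (Fin 2) ℂ))) (hU0 : ∀ ω, U 0 ω = x₀)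
    (hU : (latticeLangevinDynamics (fundamentalLatticeRep 2) β').IsSolution (fundamentalRep (Fin 2)) hW.natFiltration P W U) :
    ∫ ω, (wilsonAction (fundamentalRep (Fin 2)) (U t ω) / (Fintype.card (Plaquette 3 L) : ℝ) - (∫ y, wilsonAction (fundamentalRep (Fin 2)) y / (Fintype.card (Plaquette 3 L) : ℝ) ∂(wilsonMeasure (d := 3) (L := L) (fundamentalRep (Fin 2)) β'))) ^ 2 ∂P ≤ 32 / ((1 - 12 * |β'|) * (Fintype.card (Plaquette 3 L) : ℝ)) + (8 * Real.pi * Real.exp (-((1 - 12 * |β'|) * (t : ℝ)))) ^ 2 := by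
  classical
  haveI := secondCountableTopology_su2
  haveI := borelSpace_config L
  have hnP : 0 < (Fintype.card (Plaquette 3 L) : ℝ) := card_plaquette_three_pos L
  have hvar := wilson_solution_actionDensity_variance_le_uniform L β' hβ t x₀ Ω P W hW U hU0 hU
  have hmean := wilson_solution_actionDensity_pointwise_mixing_uniform L β' hβ t x₀ Ω P W hW U hU0 hU
  -- integrability of the (bounded, measurable) action density along the solution
  have hmU : Measurable (U t) := (hU.adapted t).mono (hW.natFiltration.le t) le_rfl
  have hSm : Measurable fun y : (GaugeConfig 3 L (Matrix.specialUnitaryGroup (Fin 2) ℂ)) => wilsonAction (fundamentalRep (Fin 2)) y / (Fintype.card (Plaquette 3 L) : ℝ) :=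
    (measurable_wilsonAction (d := 3) (L := L) (fundamentalRep (Fin 2)) (continuous_fundamentalRep (Fin 2))).div_const _
  obtain ⟨B, hB⟩ := exists_abs_wilsonAction_le (d := 3) (L := L) (fundamentalRep (Fin 2)) (continuous_fundamentalRep (Fin 2))
  have hXm : AEStronglyMeasurable (fun ω => wilsonAction (fundamentalRep (Fin 2)) (U t ω) / (Fintype.card (Plaquette 3 L) : ℝ)) P := (hSm.comp hmU).aestronglyMeasurable
  have hXb : ∀ ω, |wilsonAction (fundamentalRep (Fin 2)) (U t ω) / (Fintype.card (Plaquette 3 L) : ℝ)| ≤ B / (Fintype.card (Plaquette 3 L) : ℝ) := fun ω => by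
    rw [abs_div, abs_of_pos hnP]; exact div_le_div_of_nonneg_right (hB _) hnP.le
  have iX : Integrable (fun ω => wilsonAction (fundamentalRep (Fin 2)) (U t ω) / (Fintype.card (Plaquette 3 L) : ℝ)) P :=
    Integrable.of_bound hXm (B / (Fintype.card (Plaquette 3 L) : ℝ)) (ae_of_all _ fun ω => by rw [Real.norm_eq_abs]; exact hXb ω)
  have iXe : Integrable (fun ω => wilsonAction (fundamentalRep (Fin 2)) (U t ω) / (Fintype.card (Plaquette 3 L) : ℝ) - (∫ ω', wilsonAction (fundamentalRep (Fin 2)) (U t ω') / (Fintype.card (Plaquette 3 L) : ℝ) ∂P)) P := iX.sub (integrable_const _)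
  have i1 : Integrable (fun ω => (wilsonAction (fundamentalRep (Fin 2)) (U t ω) / (Fintype.card (Plaquette 3 L) : ℝ) - (∫ ω', wilsonAction (fundamentalRep (Fin 2)) (U t ω') / (Fintype.card (Plaquette 3 L) : ℝ) ∂P)) ^ 2) P := by
    refine Integrable.of_bound (iXe.aestronglyMeasurable.pow 2) ((B / (Fintype.card (Plaquette 3 L) : ℝ) + |(∫ ω', wilsonAction (fundamentalRep (Fin 2)) (U t ω') / (Fintype.card (Plaquette 3 L) : ℝ) ∂P)|) ^ 2) (ae_of_all _ fun ω => ?_)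
    rw [Real.norm_eq_abs, abs_pow]
    exact pow_le_pow_left₀ (abs_nonneg _) ((abs_sub _ _).trans (add_le_add (hXb ω) le_rfl)) 2
  have i2 : Integrable (fun ω => 2 * ((∫ ω', wilsonAction (fundamentalRep (Fin 2)) (U t ω') / (Fintype.card (Plaquette 3 L) : ℝ) ∂P) - (∫ y, wilsonAction (fundamentalRep (Fin 2)) y / (Fintype.card (Plaquette 3 L) : ℝ) ∂(wilsonMeasure (d := 3) (L := L) (fundamentalRep (Fin 2)) β'))) * (wilsonAction (fundamentalRep (Fin 2)) (U t ω) / (Fintype.card (Plaquette 3 L) : ℝ) - (∫ ω', wilsonAction (fundamentalRep (Fin 2)) (U t ω') / (Fintype.card (Plaquette 3 L) : ℝ) ∂P))) P := iXe.const_mul _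
  have i3 : Integrable (fun ω => 2 * ((∫ ω', wilsonAction (fundamentalRep (Fin 2)) (U t ω') / (Fintype.card (Plaquette 3 L) : ℝ) ∂P) - (∫ y, wilsonAction (fundamentalRep (Fin 2)) y / (Fintype.card (Plaquette 3 L) : ℝ) ∂(wilsonMeasure (d := 3) (L := L) (fundamentalRep (Fin 2)) β'))) * (wilsonAction (fundamentalRep (Fin 2)) (U t ω) / (Fintype.card (Plaquette 3 L) : ℝ) - (∫ ω', wilsonAction (fundamentalRep (Fin 2)) (U t ω') / (Fintype.card (Plaquette 3 L) : ℝ) ∂P)) + ((∫ ω', wilsonAction (fundamentalRep (Fin 2)) (U t ω') / (Fintype.card (Plaquette 3 L) : ℝ) ∂P) - (∫ y, wilsonAction (fundamentalRep (Fin 2)) y / (Fintype.card (Plaquette 3 L) : ℝ) ∂(wilsonMeasure (d := 3) (L := L) (fundamentalRep (Fin 2)) β'))) ^ 2) P := i2.add (integrable_const _)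
  -- bias–variance decomposition
  have hpt : ∀ ω, (wilsonAction (fundamentalRep (Fin 2)) (U t ω) / (Fintype.card (Plaquette 3 L) : ℝ) - (∫ y, wilsonAction (fundamentalRep (Fin 2)) y / (Fintype.card (Plaquette 3 L) : ℝ) ∂(wilsonMeasure (d := 3) (L := L) (fundamentalRep (Fin 2)) β'))) ^ 2 = (wilsonAction (fundamentalRep (Fin 2)) (U t ω) / (Fintype.card (Plaquette 3 L) : ℝ) - (∫ ω', wilsonAction (fundamentalRep (Fin 2)) (U t ω') / (Fintype.card (Plaquette 3 L) : ℝ) ∂P)) ^ 2 + (2 * ((∫ ω', wilsonAction (fundamentalRep (Fin 2)) (U t ω') / (Fintype.card (Plaquette 3 L) : ℝ) ∂P) - (∫ y, wilsonAction (fundamentalRep (Fin 2)) y / (Fintype.card (Plaquette 3 L) : ℝ) ∂(wilsonMeasure (d := 3) (L := L) (fundamentalRep (Fin 2)) β'))) * (wilsonAction (fundamentalRep (Fin 2)) (U t ω) / (Fintype.card (Plaquette 3 L) : ℝ) - (∫ ω', wilsonAction (fundamentalRep (Fin 2)) (U t ω') / (Fintype.card (Plaquette 3 L) : ℝ) ∂P))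 + ((∫ ω', wilsonAction (fundamentalRep (Fin 2)) (U t ω') / (Fintype.card (Plaquette 3 L) : ℝ) ∂P) - (∫ y, wilsonAction (fundamentalRep (Fin 2)) y / (Fintype.card (Plaquette 3 L) : ℝ) ∂(wilsonMeasure (d := 3) (L := L) (fundamentalRep (Fin 2)) β'))) ^ 2) := fun ω => by ring
  have hzero : ∫ ω, (wilsonAction (fundamentalRep (Fin 2)) (U t ω) / (Fintype.card (Plaquette 3 L) : ℝ) - (∫ ω', wilsonAction (fundamentalRep (Fin 2)) (U t ω') / (Fintype.card (Plaquette 3 L) : ℝ) ∂P)) ∂P = 0 := by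
    rw [integral_sub iX (integrable_const _), integral_const]
    simp only [probReal_univ, smul_eq_mul, one_mul, sub_self]
  rw [integral_congr_ae (ae_of_all _ hpt), integral_add i1 i3, integral_add i2 (integrable_const _), integral_const_mul, hzero, integral_const]
  simp only [probReal_univ, smul_eq_mul, one_mul, mul_zero, zero_add]
  have hb : ((∫ ω', wilsonAction (fundamentalRep (Fin 2)) (U t ω') / (Fintype.card (Plaquette 3 L) : ℝ) ∂P) - (∫ y, wilsonAction (fundamentalRep (Fin 2)) y / (Fintype.card (Plaquette 3 L) : ℝ) ∂(wilsonMeasure (d := 3) (L := L) (fundamentalRep (Fin 2)) β'))) ^ 2 ≤ (8 * Real.pi * Real.exp (-((1 - 12 * |β'|) * (t : ℝ)))) ^ 2 := by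
    rw [← sq_abs]; exact pow_le_pow_left₀ (abs_nonneg _) hmean 2
  exact add_le_add hvar hb

/-- ★★★ **Chebyshev tail about the Gibbs mean along every SZZ solution.**  At `|β'| < 1/12`, for every `L`, every strong solution `U` from a
deterministic start, every `t ≥ 0` and `r > 0`:
`P(|S_W(U_t)/#𝒫 − ∫ S_W/#𝒫 dμ_(β')| ≥ r) ≤ (32/((1−12|β'|)#𝒫) + (8π·e^(−(1−12|β'|)t))²)/r²`. [cite: BakryGentilLedoux2014, Thm 4.7.2 (ii), Thm 3.3.18] -/
theorem wilson_solution_actionDensity_tail_gibbsMean_le_uniform (L : ℕ) [NeZero L] (β' : ℝ) (hβ : |β'| < 1 / 12)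
    (t : ℝ≥0) (x₀ : (GaugeConfig 3 L (Matrix.specialUnitaryGroup (Fin 2) ℂ)))
    (Ω : Type) [MeasurableSpace Ω] (P : Measure Ω) [IsProbabilityMeasure P]
    (W : ℝ≥0 → Ω → (Edge 3 L × NoiseIdx 2 → ℝ)) (hW : IsFlatBrownian W P)
    (U : ℝ≥0 → Ω → (GaugeConfig 3 L (Matrix.specialUnitaryGroup (Fin 2) ℂ))) (hU0 : ∀ ω, U 0 ω = x₀)
    (hU : (latticeLangevinDynamics (fundamentalLatticeRep 2) β').IsSolution (fundamentalRep (Fin 2)) hW.natFiltration P W U) {r : ℝ} (hr : 0 < r) :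
    P.real {ω | r ≤ |wilsonAction (fundamentalRep (Fin 2)) (U t ω) / (Fintype.card (Plaquette 3 L) : ℝ) - (∫ y, wilsonAction (fundamentalRep (Fin 2)) y / (Fintype.card (Plaquette 3 L) : ℝ) ∂(wilsonMeasure (d := 3) (L := L) (fundamentalRep (Fin 2)) β'))|} ≤ (32 / ((1 - 12 * |β'|) * (Fintype.card (Plaquette 3 L) : ℝ)) + (8 * Real.pi * Real.exp (-((1 - 12 * |β'|) * (t : ℝ)))) ^ 2) / r ^ 2 := by
  classical
  haveI := secondCountableTopology_su2
  haveI := borelSpace_config L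
  have hnP : 0 < (Fintype.card (Plaquette 3 L) : ℝ) := card_plaquette_three_pos L
  have hsq := wilson_solution_actionDensity_sqDev_gibbsMean_le_uniform L β' hβ t x₀ Ω P W hW U hU0 hU
  have hmU : Measurable (U t) := (hU.adapted t).mono (hW.natFiltration.le t) le_rfl
  have hSm : Measurable fun y : (GaugeConfig 3 L (Matrix.specialUnitaryGroup (Fin 2) ℂ)) => wilsonAction (fundamentalRep (Fin 2)) y / (Fintype.card (Plaquette 3 L) : ℝ) :=
    (measurable_wilsonAction (d := 3) (L := L) (fundamentalRep (Fin 2)) (continuous_fundamentalRep (Fin 2))).div_const _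
  obtain ⟨B, hB⟩ := exists_abs_wilsonAction_le (d := 3) (L := L) (fundamentalRep (Fin 2)) (continuous_fundamentalRep (Fin 2))
  have hXm : AEStronglyMeasurable (fun ω => wilsonAction (fundamentalRep (Fin 2)) (U t ω) / (Fintype.card (Plaquette 3 L) : ℝ)) P := (hSm.comp hmU).aestronglyMeasurable
  have hXb : ∀ ω, |wilsonAction (fundamentalRep (Fin 2)) (U t ω) / (Fintype.card (Plaquette 3 L) : ℝ)| ≤ B / (Fintype.card (Plaquette 3 L) : ℝ) := fun ω => by
    rw [abs_div, abs_of_pos hnP]; exact div_le_div_of_nonneg_right (hB _) hnP.le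
  have iXm : Integrable (fun ω => wilsonAction (fundamentalRep (Fin 2)) (U t ω) / (Fintype.card (Plaquette 3 L) : ℝ) - (∫ y, wilsonAction (fundamentalRep (Fin 2)) y / (Fintype.card (Plaquette 3 L) : ℝ) ∂(wilsonMeasure (d := 3) (L := L) (fundamentalRep (Fin 2)) β'))) P :=
    (Integrable.of_bound hXm (B / (Fintype.card (Plaquette 3 L) : ℝ)) (ae_of_all _ fun ω => by rw [Real.norm_eq_abs]; exact hXb ω)).sub (integrable_const _)
  have i1 : Integrable (fun ω => (wilsonAction (fundamentalRep (Fin 2)) (U t ω) / (Fintype.card (Plaquette 3 L) : ℝ) - (∫ y, wilsonAction (fundamentalRep (Fin 2)) y / (Fintype.card (Plaquette 3 L) : ℝ) ∂(wilsonMeasure (d := 3) (L := L) (fundamentalRep (Fin 2)) β'))) ^ 2) P := by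
    refine Integrable.of_bound (iXm.aestronglyMeasurable.pow 2) ((B / (Fintype.card (Plaquette 3 L) : ℝ) + |(∫ y, wilsonAction (fundamentalRep (Fin 2)) y / (Fintype.card (Plaquette 3 L) : ℝ) ∂(wilsonMeasure (d := 3) (L := L) (fundamentalRep (Fin 2)) β'))|) ^ 2) (ae_of_all _ fun ω => ?_)
    rw [Real.norm_eq_abs, abs_pow]
    exact pow_le_pow_left₀ (abs_nonneg _) ((abs_sub _ _).trans (add_le_add (hXb ω) le_rfl)) 2
  -- Markov on the square
  have hM := mul_meas_ge_le_integral_of_nonneg (μ := P) (ae_of_all _ fun ω => sq_nonneg (wilsonAction (fundamentalRep (Fin 2)) (U t ω) / (Fintype.card (Plaquette 3 L) : ℝ) - (∫ y, wilsonAction (fundamentalRep (Fin 2)) y / (Fintype.card (Plaquette 3 L) : ℝ) ∂(wilsonMeasure (d := 3) (L := L) (fundamentalRep (Fin 2)) β')))) i1 (r ^ 2)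
  have hsub : {ω | r ≤ |wilsonAction (fundamentalRep (Fin 2)) (U t ω) / (Fintype.card (Plaquette 3 L) : ℝ) - (∫ y, wilsonAction (fundamentalRep (Fin 2)) y / (Fintype.card (Plaquette 3 L) : ℝ) ∂(wilsonMeasure (d := 3) (L := L) (fundamentalRep (Fin 2)) β'))|} ⊆ {ω | r ^ 2 ≤ (wilsonAction (fundamentalRep (Fin 2)) (U t ω) / (Fintype.card (Plaquette 3 L) : ℝ) - (∫ y, wilsonAction (fundamentalRep (Fin 2)) y / (Fintype.card (Plaquette 3 L) : ℝ) ∂(wilsonMeasure (d := 3) (L := L) (fundamentalRep (Fin 2)) β'))) ^ 2} := fun ω hω => by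
    simp only [Set.mem_setOf_eq] at hω ⊢
    exact (pow_le_pow_left₀ hr.le hω 2).trans_eq (sq_abs _)
  rw [le_div_iff₀ (pow_pos hr 2), mul_comm]
  exact (mul_le_mul_of_nonneg_left (measureReal_mono hsub) (pow_pos hr 2).le).trans (hM.trans hsq)

/-- ★★ **Volume-free thermalization time of the expected action density from every start.**  At `|β'| < 1/12`, for every `L`, every strong
solution from a deterministic start and `δ > 0`:  `log(8π/δ)/(1−12|β'|) ≤ t ⇒ |E S_W(U_t)/#𝒫 − ∫ S_W/#𝒫 dμ_(β')| ≤ δ`.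
[cite: BakryGentilLedoux2014, Thm 3.3.18] -/
theorem wilson_solution_actionDensity_thermalizationTime_uniform (L : ℕ) [NeZero L] (β' : ℝ) (hβ : |β'| < 1 / 12)
    (t : ℝ≥0) (x₀ : (GaugeConfig 3 L (Matrix.specialUnitaryGroup (Fin 2) ℂ)))
    (Ω : Type) [MeasurableSpace Ω] (P : Measure Ω) [IsProbabilityMeasure P]
    (W : ℝ≥0 → Ω → (Edge 3 L × NoiseIdx 2 → ℝ)) (hW : IsFlatBrownian W P)
    (U : ℝ≥0 → Ω → (GaugeConfig 3 L (Matrix.specialUnitaryGroup (Fin 2) ℂ))) (hU0 : ∀ ω, U 0 ω = x₀)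
    (hU : (latticeLangevinDynamics (fundamentalLatticeRep 2) β').IsSolution (fundamentalRep (Fin 2)) hW.natFiltration P W U) {δ : ℝ} (hδ : 0 < δ) (ht : Real.log (8 * Real.pi / δ) / (1 - 12 * |β'|) ≤ (t : ℝ)) :
    |∫ ω, wilsonAction (fundamentalRep (Fin 2)) (U t ω) / (Fintype.card (Plaquette 3 L) : ℝ) ∂P - (∫ y, wilsonAction (fundamentalRep (Fin 2)) y / (Fintype.card (Plaquette 3 L) : ℝ) ∂(wilsonMeasure (d := 3) (L := L) (fundamentalRep (Fin 2)) β'))| ≤ δ := by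
  have hρ : 0 < (1 - 12 * |β'|) := by linarith
  have hmean := wilson_solution_actionDensity_pointwise_mixing_uniform L β' hβ t x₀ Ω P W hW U hU0 hU
  have hu : Real.log (8 * Real.pi / δ) ≤ (1 - 12 * |β'|) * (t : ℝ) := by
    have h := (div_le_iff₀ hρ).1 ht
    linarith
  have hexp : Real.exp (-((1 - 12 * |β'|) * (t : ℝ))) ≤ δ / (8 * Real.pi) := by
    have h1 : Real.exp (-((1 - 12 * |β'|) * (t : ℝ))) ≤ Real.exp (-Real.log (8 * Real.pi / δ)) := Real.exp_le_exp.2 (by linarith)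
    rw [Real.exp_neg (Real.log (8 * Real.pi / δ)), Real.exp_log (by positivity), inv_div] at h1
    exact h1
  have hfin : 8 * Real.pi * Real.exp (-((1 - 12 * |β'|) * (t : ℝ))) ≤ δ := by
    calc 8 * Real.pi * Real.exp (-((1 - 12 * |β'|) * (t : ℝ))) ≤ 8 * Real.pi * (δ / (8 * Real.pi)) := mul_le_mul_of_nonneg_left hexp (by positivity)
      _ = δ := by field_simp
  exact hmean.trans hfin

/-- ★★ **Chebyshev tail about the Gibbs mean at the route's cut-offs, inside the window `γε_K > 6`.**  For every cut-off `K` with `6 < γε_K`,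
every strong solution of the SZZ SDE at `β'_K = (γε_K)⁻¹/2` from a deterministic start, every lattice time `t` and `r > 0`:
`P(|S_W(U_t)/(3L_K³) − ∫ S_W/(3L_K³) dμ_K| ≥ r) ≤ (32/((1 − 6/(γε_K))·3L_K³) + (8π e^(−(1−6/(γε_K))t))²)/r²`.  (Window-bound, NOT `K`-uniform.)
[cite: BakryGentilLedoux2014, Thm 4.7.2 (ii), Thm 3.3.18] -/
theorem actionDensity_tail_gibbsMean_fixedCutoff_window (F : T3ContinuumYM3Torus.T3Family) (γ : ℝ) (K : ℕ) (hK : 6 < γ * (F.P K).eps)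
    (t : ℝ≥0) (x₀ : GaugeConfig 3 ((F.P K).sitesPerDir 0) (Matrix.specialUnitaryGroup (Fin 2) ℂ))
    (Ω : Type) [MeasurableSpace Ω] (P : Measure Ω) [IsProbabilityMeasure P]
    (W : ℝ≥0 → Ω → (Edge 3 ((F.P K).sitesPerDir 0) × NoiseIdx 2 → ℝ)) (hW : IsFlatBrownian W P)
    (U : ℝ≥0 → Ω → GaugeConfig 3 ((F.P K).sitesPerDir 0) (Matrix.specialUnitaryGroup (Fin 2) ℂ)) (hU0 : ∀ ω, U 0 ω = x₀)
    (hU : (latticeLangevinDynamics (fundamentalLatticeRep 2) ((γ * (F.P K).eps)⁻¹ / 2)).IsSolution (fundamentalRep (Fin 2)) hW.natFiltration P W U) {r : ℝ} (hr : 0 < r) :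
    P.real {ω | r ≤ |wilsonAction (fundamentalRep (Fin 2)) (U t ω) / (3 * (((((F.P K).sitesPerDir 0) : ℕ) : ℝ) ^ 3)) - (∫ y, wilsonAction (fundamentalRep (Fin 2)) y / (3 * (((((F.P K).sitesPerDir 0) : ℕ) : ℝ) ^ 3)) ∂(wilsonMeasure (d := 3) (L := ((F.P K).sitesPerDir 0)) (fundamentalRep (Fin 2)) ((γ * (F.P K).eps)⁻¹ / 2)))|} ≤ (32 / ((1 - 6 / (γ * (F.P K).eps)) * (3 * (((((F.P K).sitesPerDir 0) : ℕ) : ℝ) ^ 3))) + (8 * Real.pi * Real.exp (-((1 - 6 / (γ * (F.P K).eps)) * (t : ℝ)))) ^ 2) / r ^ 2 := by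
  obtain ⟨hβ, hrate⟩ := window_coupling_bounds F γ K hK
  have h := wilson_solution_actionDensity_tail_gibbsMean_le_uniform ((F.P K).sitesPerDir 0) ((γ * (F.P K).eps)⁻¹ / 2) hβ t x₀ Ω P W hW U hU0 hU hr
  rw [(card_site_plaquette_fixedCutoff F K).2, hrate] at h
  exact h

/-- ★★ **Volume-free thermalization time at the route's cut-offs, inside the window `γε_K > 6`.**  For every cut-off `K` with `6 < γε_K`, every
strong solution at `β'_K` from a deterministic start (e.g. the COLD start) and `δ > 0`:
`log(8π/δ)/(1 − 6/(γε_K)) ≤ t ⇒ |E S_W(U_t)/(3L_K³) − ∫ S_W/(3L_K³) dμ_K| ≤ δ` — a lattice-time threshold independent of `L_K`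
(physical time `ε_K·t`; window-bound, NOT `K`-uniform in the sense of stmt-24809). [cite: BakryGentilLedoux2014, Thm 3.3.18] -/
theorem actionDensity_thermalizationTime_fixedCutoff_window (F : T3ContinuumYM3Torus.T3Family) (γ : ℝ) (K : ℕ) (hK : 6 < γ * (F.P K).eps)
    (t : ℝ≥0) (x₀ : GaugeConfig 3 ((F.P K).sitesPerDir 0) (Matrix.specialUnitaryGroup (Fin 2) ℂ))
    (Ω : Type) [MeasurableSpace Ω] (P : Measure Ω) [IsProbabilityMeasure P]
    (W : ℝ≥0 → Ω → (Edge 3 ((F.P K).sitesPerDir 0) × NoiseIdx 2 → ℝ)) (hW : IsFlatBrownian W P)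
    (U : ℝ≥0 → Ω → GaugeConfig 3 ((F.P K).sitesPerDir 0) (Matrix.specialUnitaryGroup (Fin 2) ℂ)) (hU0 : ∀ ω, U 0 ω = x₀)
    (hU : (latticeLangevinDynamics (fundamentalLatticeRep 2) ((γ * (F.P K).eps)⁻¹ / 2)).IsSolution (fundamentalRep (Fin 2)) hW.natFiltration P W U) {δ : ℝ} (hδ : 0 < δ) (ht : Real.log (8 * Real.pi / δ) / (1 - 6 / (γ * (F.P K).eps)) ≤ (t : ℝ)) :
    |∫ ω, wilsonAction (fundamentalRep (Fin 2)) (U t ω) / (3 * (((((F.P K).sitesPerDir 0) : ℕ) : ℝ) ^ 3)) ∂P - (∫ y, wilsonAction (fundamentalRep (Fin 2)) y / (3 * (((((F.P K).sitesPerDir 0) : ℕ) : ℝ) ^ 3)) ∂(wilsonMeasure (d := 3) (L := ((F.P K).sitesPerDir 0)) (fundamentalRep (Fin 2)) ((γ * (F.P K).eps)⁻¹ / 2)))| ≤ δ := by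
  obtain ⟨hβ, hrate⟩ := window_coupling_bounds F γ K hK
  rw [← hrate] at ht
  have h := wilson_solution_actionDensity_thermalizationTime_uniform ((F.P K).sitesPerDir 0) ((γ * (F.P K).eps)⁻¹ / 2) hβ t x₀ Ω P W hW U hU0 hU hδ ht
  rw [(card_site_plaquette_fixedCutoff F K).2] at h
  exact h

end Summit.QuantumFields.YangMills.Theorems.ColdStartUniversality
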